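import Summits.RiemannHypothesis.RiemannHypothesis.Theorems.SuzukiWindowsDoorArchKernel
import Summits.RiemannHypothesis.RiemannHypothesis.Theorems.SuzukiWindowsDoorExplicitSymbol

/-!
# SuzukiWindowsDoorArchLeadingSymbol — the Stirling leading term of the archimedean symbol: `Θ_θ^arch(s) = (2π)^θ s^{−θ} (1 + O(θ/|s|))` (column DBR; RH-FREE)

RH-FREE throughout (no `ζ` beyond the tree's explicit formula for `ξ'/ξ` on `Re s > 1`); nothing here bears on the
truth of RH.  For Suzuki's archimedean symbol `Θ_θ^arch(z) = exp(−2θ γ'/γ(s))`, `s = ½ − iz`, `γ(s) = ½ s(s−1)π^{−s/2}Γ(s/2)`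
([Su20] = arXiv:1907.07302, (1.11), §3 «by Stirling's formula»), and INTEGER `θ = k + 1 ≥ 2`:

* §1 `γ'/γ(s) = 1/s + 1/(s−1) − (log π)/2 + ½ψ(s/2)` on `Re s > 1` (tree's `ξ'/ξ` formula + file 1's `ξ'/ξ = γ'/γ − ΣΛn^{-s}`);
* §2 the exact factorisation `Θ_{k+1}^arch(z) = (2π)^{k+1} (s^{k+1})⁻¹ · exp(w(s))` with
  `w(s) = −θ/s − 2θ/(s−1) + θ/(3s²) − θ·R(s)`, `R(s) = ψ(s/2) − (log(s/2) − 1/s − 1/(3s²))` (order-1 Stirling remainder,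
  `‖R(s)‖ ≤ 2/(π Re s ‖s‖²)` by `SuzukiWindowsDoorExplicitSymbol.norm_digamma_half_sub_le`), and `‖w(s)‖ ≤ 6θ/‖s‖` for
  `Re s ≥ 2`;
* §3 **`‖Θ_{k+1}^arch(z) − (2π)^{k+1}((½ − iz)^{k+1})⁻¹‖ ≤ 12(k+1)(2π)^{k+1}/‖½ − iz‖^{k+2}`** for `Re(½ − iz) ≥ 6(k+1)`
  (`‖e^w − 1‖ ≤ 2‖w‖` for `‖w‖ ≤ 1`).

Companion of `SuzukiWindowsDoorLaplacePower` (the exact line transform of `(½ − iz)^{−(k+1)}`); the sequel bounds the line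
integral of the remainder and gives the small-`x` law `g_θ(x) = (2π)^θ x^{θ−1}e^{−x/2}/Γ(θ)·(1 + O(x))`.

References: [Su20] M. Suzuki, ASPM 84 (2020), §3; DLMF 5.11.2.
-/

noncomputable section

-- D-0017: `Summit.<S>.<S>.…` is the designed namespace of a single-problem summit.
set_option linter.dupNamespace false

open Filter Topology Complex

namespace Summit.RiemannHypothesis.RiemannHypothesis.Theorems.SuzukiWindowsDoorArchLeadingSymbol

open Literature.NumberTheory.LFunctions
open LSeries
open scoped LSeries.notation ArithmeticFunction.vonMangoldt
open SuzukiWindowsDoorArchKernel (logDeriv_riemannXi_eq_arch_sub re_half_sub_I_mul)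
open SuzukiWindowsDoorExplicitSymbol (norm_digamma_half_sub_le)

/-! ## §1 `γ'/γ` on `Re s > 1` -/

/-- RH-FREE.  **`γ'/γ(s) = 1/s + 1/(s−1) − (log π)/2 + ½ ψ(s/2)`** on `Re s > 1`. -/
theorem logDeriv_xiGammaFactor_eq {s : ℂ} (hs : 1 < s.re) :
    deriv xiGammaFactor s / xiGammaFactor s =
      1 / s + 1 / (s - 1) + (-(Real.log Real.pi : ℂ) / 2 + 1 / 2 * Complex.digamma (s / 2)) := by
  have h1 := logDeriv_riemannXi_eq_arch_sub hs
  have h2 := logDeriv_riemannXi_eq_of_one_lt_re hs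
  rw [logDeriv_apply] at h2
  have h3 : deriv xiGammaFactor s / xiGammaFactor s = deriv riemannXi s / riemannXi s + L ↗Λ s := by
    rw [h1]; ring
  rw [h3, h2]
  ring

/-! ## §2 The exact factorisation `Θ_{k+1}^arch = (2π)^{k+1} s^{−(k+1)} e^{w(s)}` and the size of `w` -/

/-- `log(s/2) = log s − log 2` for `Re s > 0`. -/
theorem log_half_eq {s : ℂ} (hs : 0 < s.re) : Complex.log (s / 2) = Complex.log s - Real.log 2 := by
  have hs0 : s ≠ 0 := fun h => by rw [h] at hs; simp at hs
  rw [div_eq_mul_inv, show (2 : ℂ)⁻¹ = ((2⁻¹ : ℝ) : ℂ) by push_cast; ring, mul_comm,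
    Complex.log_ofReal_mul (by norm_num) hs0, Real.log_inv]
  push_cast
  ring

/-- RH-FREE.  **Exact factorisation**: for `Im z > ½`, `s = ½ − iz` and integer `θ = k+1`,
`Θ_{k+1}^arch(z) = (2π)^{k+1} · (s^{k+1})⁻¹ · exp(w(s))`,
`w(s) = −θ/s − 2θ/(s−1) + θ/(3s²) − θ·(ψ(s/2) − (log(s/2) − 1/s − 1/(3s²)))`. -/
theorem limThetaArch_eq_leading_mul_exp (k : ℕ) {z : ℂ} (hz : 1 / 2 < z.im) :
    limThetaArch ((k : ℝ) + 1) z =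
      (2 * Real.pi : ℂ) ^ (k + 1) * (((1 : ℂ) / 2 - I * z) ^ (k + 1))⁻¹ *
        Complex.exp (-((k : ℂ) + 1) / ((1 : ℂ) / 2 - I * z) - 2 * ((k : ℂ) + 1) / ((1 : ℂ) / 2 - I * z - 1)
          + ((k : ℂ) + 1) / (3 * ((1 : ℂ) / 2 - I * z) ^ 2)
          - ((k : ℂ) + 1) * (Complex.digamma (((1 : ℂ) / 2 - I * z) / 2)
              - (Complex.log (((1 : ℂ) / 2 - I * z) / 2) - 1 / ((1 : ℂ) / 2 - I * z)
                  - 1 / (3 * ((1 : ℂ) / 2 - I * z) ^ 2)))) := by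
  set s : ℂ := (1 : ℂ) / 2 - I * z with hsdef
  have hre : 1 < s.re := by rw [hsdef, re_half_sub_I_mul]; linarith
  have hre0 : 0 < s.re := by linarith
  have hs0 : s ≠ 0 := fun h => by rw [h] at hre; norm_num at hre
  have hs1 : s - 1 ≠ 0 := by
    intro h
    have h' := congrArg Complex.re h
    simp at h'
    linarith
  have h2π : (0 : ℝ) < 2 * Real.pi := by positivity
  unfold limThetaArch
  rw [← hsdef, logDeriv_xiGammaFactor_eq hre, log_half_eq hre0]
  -- the power `(2π)^{k+1}` and `s^{-(k+1)}` as exponentials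
  have hpow : (2 * Real.pi : ℂ) ^ (k + 1) = Complex.exp (((k : ℂ) + 1) * (Real.log (2 * Real.pi) : ℂ)) := by
    rw [show ((k : ℂ) + 1) = ((k + 1 : ℕ) : ℂ) by push_cast; ring, Complex.exp_nat_mul,
      Complex.ofReal_log h2π.le, Complex.exp_log (by exact_mod_cast h2π.ne')]
    push_cast
    ring
  have hinv : (s ^ (k + 1))⁻¹ = Complex.exp (-(((k : ℂ) + 1) * Complex.log s)) := by
    rw [Complex.exp_neg, show ((k : ℂ) + 1) = ((k + 1 : ℕ) : ℂ) by push_cast; ring, Complex.exp_nat_mul,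
      Complex.exp_log hs0]
  rw [hpow, hinv, ← Complex.exp_add, ← Complex.exp_add]
  congr 1
  rw [Real.log_mul (by norm_num) Real.pi_pos.ne']
  push_cast
  field_simp
  ring

/-- `‖s − 1‖ ≥ ‖s‖/2` when `‖s‖ ≥ 2`. -/
theorem norm_sub_one_ge {s : ℂ} (hs : 2 ≤ ‖s‖) : ‖s‖ / 2 ≤ ‖s - 1‖ := by
  have h := norm_sub_norm_le s 1
  rw [norm_one] at h
  have h' : ‖s‖ - 1 ≤ ‖s - 1‖ := by linarith [abs_le.1 (abs_norm_sub_norm_le s 1)]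
  linarith

/-- RH-FREE.  **Size of the correction**: for `Re s ≥ 2` and `θ ≥ 0`,
`‖−θ/s − 2θ/(s−1) + θ/(3s²) − θ R(s)‖ ≤ 6θ/‖s‖` (`‖R(s)‖ ≤ 2/(π Re s ‖s‖²)`, order-1 Stirling). -/
theorem norm_correction_le {θ : ℝ} (hθ : 0 ≤ θ) {s : ℂ} (hs : 2 ≤ s.re) :
    ‖-(θ : ℂ) / s - 2 * (θ : ℂ) / (s - 1) + (θ : ℂ) / (3 * s ^ 2)
        - (θ : ℂ) * (Complex.digamma (s / 2) - (Complex.log (s / 2) - 1 / s - 1 / (3 * s ^ 2)))‖ ≤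
      6 * θ / ‖s‖ := by
  have hns : 2 ≤ ‖s‖ := le_trans hs (Complex.re_le_norm s)
  have hns0 : 0 < ‖s‖ := by linarith
  have hs0 : s ≠ 0 := norm_pos_iff.1 hns0
  have hs1 : ‖s‖ / 2 ≤ ‖s - 1‖ := norm_sub_one_ge hns
  have hs1pos : 0 < ‖s - 1‖ := by linarith
  have hR := norm_digamma_half_sub_le (s := s) (by linarith)
  -- the four terms
  have t1 : ‖-(θ : ℂ) / s‖ = θ / ‖s‖ := by
    rw [norm_div, norm_neg, Complex.norm_real, Real.norm_of_nonneg hθ]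
  have t2 : ‖2 * (θ : ℂ) / (s - 1)‖ ≤ 4 * θ / ‖s‖ := by
    rw [norm_div, norm_mul, Complex.norm_two, Complex.norm_real, Real.norm_of_nonneg hθ]
    rw [div_le_div_iff₀ hs1pos hns0]
    nlinarith
  have t3 : ‖(θ : ℂ) / (3 * s ^ 2)‖ ≤ θ / 6 / ‖s‖ := by
    rw [norm_div, norm_mul, Complex.norm_real, Real.norm_of_nonneg hθ, norm_pow,
      show ‖(3 : ℂ)‖ = 3 by simp]
    rw [div_le_div_iff₀ (by positivity) hns0]
    nlinarith [mul_nonneg (mul_nonneg hθ hns0.le) (sub_nonneg.2 hns)]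
  have t4 : ‖(θ : ℂ) * (Complex.digamma (s / 2) - (Complex.log (s / 2) - 1 / s - 1 / (3 * s ^ 2)))‖ ≤
      θ / 6 / ‖s‖ := by
    rw [norm_mul, Complex.norm_real, Real.norm_of_nonneg hθ]
    have hRle : 2 / (Real.pi * s.re * ‖s‖ ^ 2) ≤ 1 / 6 / ‖s‖ := by
      have hpi : 3 < Real.pi := Real.pi_gt_three
      have hsre : 0 < s.re := by linarith
      rw [div_le_div_iff₀ (by positivity) hns0]
      have h6 : 6 ≤ Real.pi * s.re := by nlinarith [mul_nonneg Real.pi_pos.le (sub_nonneg.2 hs)]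
      have h7 : ‖s‖ * 2 ≤ ‖s‖ ^ 2 := by nlinarith
      nlinarith [mul_le_mul_of_nonneg_right h6 (sq_nonneg ‖s‖)]
    calc θ * ‖Complex.digamma (s / 2) - (Complex.log (s / 2) - 1 / s - 1 / (3 * s ^ 2))‖
        ≤ θ * (1 / 6 / ‖s‖) := mul_le_mul_of_nonneg_left (hR.trans hRle) hθ
      _ = θ / 6 / ‖s‖ := by ring
  have tri : ‖-(θ : ℂ) / s - 2 * (θ : ℂ) / (s - 1) + (θ : ℂ) / (3 * s ^ 2)
          - (θ : ℂ) * (Complex.digamma (s / 2) - (Complex.log (s / 2) - 1 / s - 1 / (3 * s ^ 2)))‖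
      ≤ ‖-(θ : ℂ) / s‖ + ‖2 * (θ : ℂ) / (s - 1)‖ + ‖(θ : ℂ) / (3 * s ^ 2)‖ +
          ‖(θ : ℂ) * (Complex.digamma (s / 2) - (Complex.log (s / 2) - 1 / s - 1 / (3 * s ^ 2)))‖ := by
    refine (norm_sub_le _ _).trans ?_
    gcongr
    refine (norm_add_le _ _).trans ?_
    gcongr
    exact norm_sub_le _ _
  refine tri.trans ?_
  have hsum : ‖-(θ : ℂ) / s‖ + ‖2 * (θ : ℂ) / (s - 1)‖ + ‖(θ : ℂ) / (3 * s ^ 2)‖ +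
      ‖(θ : ℂ) * (Complex.digamma (s / 2) - (Complex.log (s / 2) - 1 / s - 1 / (3 * s ^ 2)))‖ ≤
      θ / ‖s‖ + 4 * θ / ‖s‖ + θ / 6 / ‖s‖ + θ / 6 / ‖s‖ := by
    rw [t1]
    gcongr
  refine hsum.trans ?_
  rw [show θ / ‖s‖ + 4 * θ / ‖s‖ + θ / 6 / ‖s‖ + θ / 6 / ‖s‖ = (16 / 3 * θ) / ‖s‖ by
    field_simp; ring]
  exact div_le_div_of_nonneg_right (by nlinarith) hns0.le

/-! ## §3 The leading term with an explicit remainder -/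

/-- RH-FREE.  **Stirling leading term of `Θ_{k+1}^arch` with explicit remainder**: for integer `θ = k+1 ≥ 1` and
`Re(½ − iz) ≥ 6(k+1)` (so `Im z > ½`),
`‖Θ_{k+1}^arch(z) − (2π)^{k+1} ((½ − iz)^{k+1})⁻¹‖ ≤ 12(k+1)(2π)^{k+1} / ‖½ − iz‖^{k+2}`. -/
theorem norm_limThetaArch_sub_leading_le (k : ℕ) {z : ℂ} (hz : 6 * ((k : ℝ) + 1) ≤ ((1 : ℂ) / 2 - I * z).re) :
    ‖limThetaArch ((k : ℝ) + 1) z - (2 * Real.pi : ℂ) ^ (k + 1) * (((1 : ℂ) / 2 - I * z) ^ (k + 1))⁻¹‖ ≤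
      12 * ((k : ℝ) + 1) * (2 * Real.pi) ^ (k + 1) / ‖(1 : ℂ) / 2 - I * z‖ ^ (k + 2) := by
  set s : ℂ := (1 : ℂ) / 2 - I * z with hsdef
  have hk1 : (1 : ℝ) ≤ (k : ℝ) + 1 := by have : (0:ℝ) ≤ k := Nat.cast_nonneg k; linarith
  have hre2 : 2 ≤ s.re := by linarith
  have hzim : 1 / 2 < z.im := by
    have h := re_half_sub_I_mul z
    rw [← hsdef] at h
    linarith
  have hns : 6 * ((k : ℝ) + 1) ≤ ‖s‖ := le_trans hz (Complex.re_le_norm s)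
  have hns0 : 0 < ‖s‖ := by linarith
  have hs0 : s ≠ 0 := norm_pos_iff.1 hns0
  -- the correction `w`
  set w : ℂ := -((k : ℂ) + 1) / s - 2 * ((k : ℂ) + 1) / (s - 1) + ((k : ℂ) + 1) / (3 * s ^ 2)
      - ((k : ℂ) + 1) * (Complex.digamma (s / 2) - (Complex.log (s / 2) - 1 / s - 1 / (3 * s ^ 2))) with hwdef
  have hw : ‖w‖ ≤ 6 * ((k : ℝ) + 1) / ‖s‖ := by
    have h := norm_correction_le (θ := (k : ℝ) + 1) (by linarith) hre2
    have e : -(((k : ℝ) + 1 : ℝ) : ℂ) / s - 2 * (((k : ℝ) + 1 : ℝ) : ℂ) / (s - 1) + (((k : ℝ) + 1 : ℝ) : ℂ) / (3 * s ^ 2)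
        - (((k : ℝ) + 1 : ℝ) : ℂ) * (Complex.digamma (s / 2) - (Complex.log (s / 2) - 1 / s - 1 / (3 * s ^ 2))) = w := by
      rw [hwdef]; push_cast; ring
    rwa [e] at h
  have hw1 : ‖w‖ ≤ 1 := by
    refine hw.trans ?_
    rw [div_le_one hns0]
    exact hns
  have hfac : limThetaArch ((k : ℝ) + 1) z = (2 * Real.pi : ℂ) ^ (k + 1) * (s ^ (k + 1))⁻¹ * Complex.exp w := by
    rw [limThetaArch_eq_leading_mul_exp k hzim]
  rw [hfac, show (2 * Real.pi : ℂ) ^ (k + 1) * (s ^ (k + 1))⁻¹ * Complex.exp w -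
      (2 * Real.pi : ℂ) ^ (k + 1) * (s ^ (k + 1))⁻¹ =
      (2 * Real.pi : ℂ) ^ (k + 1) * (s ^ (k + 1))⁻¹ * (Complex.exp w - 1) by ring,
    norm_mul, norm_mul, norm_inv, norm_pow, norm_pow,
    show ‖(2 * Real.pi : ℂ)‖ = 2 * Real.pi by
      rw [show (2 * Real.pi : ℂ) = ((2 * Real.pi : ℝ) : ℂ) by push_cast; ring, Complex.norm_real,
        Real.norm_of_nonneg (by positivity)]]
  have hexp : ‖Complex.exp w - 1‖ ≤ 2 * (6 * ((k : ℝ) + 1) / ‖s‖) :=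
    (Complex.norm_exp_sub_one_le hw1).trans (by linarith)
  calc (2 * Real.pi) ^ (k + 1) * (‖s‖ ^ (k + 1))⁻¹ * ‖Complex.exp w - 1‖
      ≤ (2 * Real.pi) ^ (k + 1) * (‖s‖ ^ (k + 1))⁻¹ * (2 * (6 * ((k : ℝ) + 1) / ‖s‖)) :=
        mul_le_mul_of_nonneg_left hexp (by positivity)
    _ = 12 * ((k : ℝ) + 1) * (2 * Real.pi) ^ (k + 1) / ‖s‖ ^ (k + 2) := by
        rw [pow_succ ‖s‖ (k + 1)]
        field_simp
        ring

end Summit.RiemannHypothesis.RiemannHypothesis.Theorems.SuzukiWindowsDoorArchLeadingSymbol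

end
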